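import Mathlib
import HarnessLib
import Summits.Ventures.LatticeQCDFlow.Exactness.NCMCGeneralSpaceBennettRootConsistency

/-!
# The sample Bennett equation is the score equation of a strictly concave log-likelihood; the BAR estimate is its unique maximiser

HONEST FRAMING: exact (Metropolis-corrected) sampling algorithms for lattice gauge theory;
figures of merit are autocorrelation/cost numbers at stated couplings and volumes; no
continuum-physics claim.

Venture `LatticeQCDFlow` (cell pub-lqcd), topic `Exactness`; FANOUT row 13 (`eng-snf`, GEN-15).
NEW WORK of the cell (one-variable calculus on the sample), not a published result; nothing is cited
as a fact — the maximum-likelihood READING of Bennett's estimator (M. R. Shirts, E. Bair, G. Hooker,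
V. S. Pande, Phys. Rev. Lett. 91 (2003) 140601) is named only, and what is typed is the elementary
statement behind it for the sample equation of `NCMCGeneralSpaceBennettRootConsistency.lean`.

## Content

For a paired run `ω : ℕ → E × E` (forward works `W(ω i).1`, works read on the reverse records
`W(ω i).2`) and `n` pairs, the LOGISTIC LOG-LIKELIHOOD of the free-energy parameter `d` is
`ℓ_n(d, ω) = Σ_{i<n} log σ(W(ω i).1 − d) + Σ_{i<n} log σ(d − W(ω i).2)` (`σ = Real.sigmoid`): along a
Crooks pair `dP_F/dP_R = e^{W − ΔF}` on records, so with equally many forward and reverse records the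
probability that a record carrying work `w` is a forward one is `σ(w − ΔF)`, and `ℓ_n(d)` is the
log-probability of the observed forward/reverse labels under the candidate value `d`.

* `hasDerivAt_log_sigmoid` — `(log σ)' = 1 − σ`.
* **`hasDerivAt_barLogLik`** — THE SCORE IS MINUS THE SAMPLE BENNETT GAP:
  `ℓ_n'(d) = −g_n(d) = −(Σ σ(d − W_F,i) − Σ σ(W_R,i − d))`; so the sample Bennett equation
  `g_n(d) = 0` (the equation `snf.estimators.bar` solves) is the likelihood equation.
* `continuous_barLogLik`, **`strictConcaveOn_barLogLik`** — `ℓ_n` is strictly concave once `n ≥ 1`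
  (its derivative `−g_n` is strictly decreasing, `sampleBarGap_strictMono`).
* **`barLogLik_lt_of_ne_root`** — if `g_n(d̂) = 0` then `ℓ_n(d) < ℓ_n(d̂)` for every `d ≠ d̂`:
  THE BAR ESTIMATE IS THE UNIQUE MAXIMISER of the logistic log-likelihood
  (`eq_root_of_isMaxOn_barLogLik`: any maximiser is the root).
* `hasDerivAt_sampleBarGap` — `g_n'(d) = Σ σ'(d − W_F,i) + Σ σ'(W_R,i − d) > 0` (`σ' = σ(1 − σ)`): the
  observed information `−ℓ_n'' = g_n'`.  Remark (not a theorem here): at the root `g_n'/n` estimates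
  the overlap `G` (`…BennettRootVariance.barSensitivity_eq_overlap`), and the naive inverse-information
  error bar `1/√(n Ĝ)` EXCEEDS the correct `√((1/Ĝ − 2)/n)` of `…BennettRootStudentizedCLT` — the
  labels are not random (the sample sizes are fixed), which removes `2/n` from the variance.

Scope: deterministic statements about the sample functions (every run, every `n`); paired samples
(shift `M = 0`); nothing probabilistic is claimed in this file.
-/

namespace Summit.Ventures.LatticeQCDFlow.Exactness.GeneralNCMC

open Set Filter Finset
open scoped Topology

variable {E : Type*}

/-! ## Calculus of `log σ` -/

/-- `(log σ)'(x) = 1 − σ(x)`. -/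
theorem hasDerivAt_log_sigmoid (x : ℝ) :
    HasDerivAt (fun x => Real.log (Real.sigmoid x)) (1 - Real.sigmoid x) x := by
  have h := (Real.hasDerivAt_log (Real.sigmoid_pos x).ne').comp x (Real.hasDerivAt_sigmoid x)
  have hσ : (Real.sigmoid x)⁻¹ * (Real.sigmoid x * (1 - Real.sigmoid x)) = 1 - Real.sigmoid x := by
    rw [← mul_assoc, inv_mul_cancel₀ (Real.sigmoid_pos x).ne', one_mul]
  rw [← hσ]
  simpa [Function.comp_def] using h

/-- `d ↦ log σ(a − d)` has derivative `−σ(d − a)`. -/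
theorem hasDerivAt_log_sigmoid_sub_left (a d : ℝ) :
    HasDerivAt (fun d => Real.log (Real.sigmoid (a - d))) (-Real.sigmoid (d - a)) d := by
  have h := (hasDerivAt_log_sigmoid (a - d)).comp d ((hasDerivAt_const d a).sub (hasDerivAt_id d))
  have hval : (1 - Real.sigmoid (a - d)) * (0 - 1) = -Real.sigmoid (d - a) := by
    rw [show d - a = -(a - d) by ring, Real.sigmoid_neg]
    ring
  rw [← hval]
  simpa [Function.comp_def] using h

/-- `d ↦ log σ(d − b)` has derivative `σ(b − d)`. -/
theorem hasDerivAt_log_sigmoid_sub_right (b d : ℝ) :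
    HasDerivAt (fun d => Real.log (Real.sigmoid (d - b))) (Real.sigmoid (b - d)) d := by
  have h := (hasDerivAt_log_sigmoid (d - b)).comp d ((hasDerivAt_id d).sub_const b)
  have hval : (1 - Real.sigmoid (d - b)) * 1 = Real.sigmoid (b - d) := by
    rw [show b - d = -(d - b) by ring, Real.sigmoid_neg, mul_one]
  rw [← hval]
  simpa [Function.comp_def] using h

/-! ## The logistic log-likelihood of a paired sample -/

section Sample

variable (W : E → ℝ)

/-- **The score is minus the sample Bennett gap**: `ℓ_n'(d) = −(Σ_{i<n} σ(d − W_F,i) − Σ_{i<n} σ(W_R,i − d))`. -/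
theorem hasDerivAt_barLogLik (ω : ℕ → E × E) (n : ℕ) (d : ℝ) :
    HasDerivAt (fun d : ℝ => (∑ i ∈ range n, Real.log (Real.sigmoid (W (ω i).1 - d))) +
        ∑ i ∈ range n, Real.log (Real.sigmoid (d - W (ω i).2)))
      (-((∑ i ∈ range n, Real.sigmoid (d - W (ω i).1)) -
        ∑ i ∈ range n, Real.sigmoid (W (ω i).2 - d))) d := by
  have h1 : HasDerivAt (fun d : ℝ => ∑ i ∈ range n, Real.log (Real.sigmoid (W (ω i).1 - d)))
      (∑ i ∈ range n, -Real.sigmoid (d - W (ω i).1)) d :=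
    HasDerivAt.fun_sum fun i _ => hasDerivAt_log_sigmoid_sub_left (W (ω i).1) d
  have h2 : HasDerivAt (fun d : ℝ => ∑ i ∈ range n, Real.log (Real.sigmoid (d - W (ω i).2)))
      (∑ i ∈ range n, Real.sigmoid (W (ω i).2 - d)) d :=
    HasDerivAt.fun_sum fun i _ => hasDerivAt_log_sigmoid_sub_right (W (ω i).2) d
  refine (h1.add h2).congr_deriv ?_
  rw [sum_neg_distrib]
  ring

/-- The logistic log-likelihood is continuous in `d`. -/
theorem continuous_barLogLik (ω : ℕ → E × E) (n : ℕ) :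
    Continuous fun d : ℝ => (∑ i ∈ range n, Real.log (Real.sigmoid (W (ω i).1 - d))) +
      ∑ i ∈ range n, Real.log (Real.sigmoid (d - W (ω i).2)) :=
  continuous_iff_continuousAt.2 fun d => (hasDerivAt_barLogLik W ω n d).continuousAt

/-- Its derivative, as a function. -/
theorem deriv_barLogLik (ω : ℕ → E × E) (n : ℕ) :
    deriv (fun d : ℝ => (∑ i ∈ range n, Real.log (Real.sigmoid (W (ω i).1 - d))) +
        ∑ i ∈ range n, Real.log (Real.sigmoid (d - W (ω i).2))) =
      fun d => -((∑ i ∈ range n, Real.sigmoid (d - W (ω i).1)) -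
        ∑ i ∈ range n, Real.sigmoid (W (ω i).2 - d)) :=
  funext fun d => (hasDerivAt_barLogLik W ω n d).deriv

/-- **The logistic log-likelihood is strictly concave** once one pair has been sampled (`n ≥ 1`):
its derivative `−g_n` is strictly decreasing. -/
theorem strictConcaveOn_barLogLik (ω : ℕ → E × E) {n : ℕ} (hn : 1 ≤ n) :
    StrictConcaveOn ℝ univ fun d : ℝ => (∑ i ∈ range n, Real.log (Real.sigmoid (W (ω i).1 - d))) +
      ∑ i ∈ range n, Real.log (Real.sigmoid (d - W (ω i).2)) := by
  refine StrictAntiOn.strictConcaveOn_of_deriv convex_univ (continuous_barLogLik W ω n).continuousOn ?_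
  rw [interior_univ, deriv_barLogLik W ω n]
  intro a _ b _ hab
  exact neg_lt_neg (sampleBarGap_strictMono W ω hn hab)

/-- **The BAR estimate is the unique maximiser of the logistic log-likelihood**: if `d̂` solves the
sample Bennett equation (`n ≥ 1`), then `ℓ_n(d) < ℓ_n(d̂)` for every `d ≠ d̂`. -/
theorem barLogLik_lt_of_ne_root (ω : ℕ → E × E) {n : ℕ} (hn : 1 ≤ n) {dhat : ℝ}
    (hroot : (∑ i ∈ range n, Real.sigmoid (dhat - W (ω i).1)) -
      ∑ i ∈ range n, Real.sigmoid (W (ω i).2 - dhat) = 0) {d : ℝ} (hd : d ≠ dhat) :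
    (∑ i ∈ range n, Real.log (Real.sigmoid (W (ω i).1 - d))) +
        ∑ i ∈ range n, Real.log (Real.sigmoid (d - W (ω i).2)) <
      (∑ i ∈ range n, Real.log (Real.sigmoid (W (ω i).1 - dhat))) +
        ∑ i ∈ range n, Real.log (Real.sigmoid (dhat - W (ω i).2)) := by
  set ℓ := fun d : ℝ => (∑ i ∈ range n, Real.log (Real.sigmoid (W (ω i).1 - d))) +
    ∑ i ∈ range n, Real.log (Real.sigmoid (d - W (ω i).2)) with hℓ
  have hmono := sampleBarGap_strictMono W ω hn
  have hcont := continuous_barLogLik W ω n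
  have hderiv := deriv_barLogLik W ω n
  show ℓ d < ℓ dhat
  rcases lt_or_gt_of_ne hd with hlt | hgt
  · -- left of the root the score `−g_n` is positive: `ℓ` increases on `[d, d̂]`
    have hsm : StrictMonoOn ℓ (Icc d dhat) := by
      refine strictMonoOn_of_deriv_pos (convex_Icc d dhat) hcont.continuousOn fun x hx => ?_
      rw [interior_Icc] at hx
      rw [hℓ, hderiv]
      have := hmono hx.2
      dsimp only at this ⊢
      linarith
    exact hsm (left_mem_Icc.2 hlt.le) (right_mem_Icc.2 hlt.le) hlt
  · -- right of the root the score is negative: `ℓ` decreases on `[d̂, d]`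
    have hsa : StrictAntiOn ℓ (Icc dhat d) := by
      refine strictAntiOn_of_deriv_neg (convex_Icc dhat d) hcont.continuousOn fun x hx => ?_
      rw [interior_Icc] at hx
      rw [hℓ, hderiv]
      have := hmono hx.1
      dsimp only at this ⊢
      linarith
    exact hsa (left_mem_Icc.2 hgt.le) (right_mem_Icc.2 hgt.le) hgt

/-- … hence **any maximiser of the logistic log-likelihood is the root** of the sample Bennett
equation (which exists and is unique, `existsUnique_sampleBarGap_root`). -/
theorem eq_root_of_isMaxOn_barLogLik (ω : ℕ → E × E) {n : ℕ} (hn : 1 ≤ n) {dhat : ℝ}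
    (hroot : (∑ i ∈ range n, Real.sigmoid (dhat - W (ω i).1)) -
      ∑ i ∈ range n, Real.sigmoid (W (ω i).2 - dhat) = 0) {d : ℝ}
    (hmax : IsMaxOn (fun d : ℝ => (∑ i ∈ range n, Real.log (Real.sigmoid (W (ω i).1 - d))) +
      ∑ i ∈ range n, Real.log (Real.sigmoid (d - W (ω i).2))) univ d) :
    d = dhat := by
  by_contra hd
  have hlt := barLogLik_lt_of_ne_root W ω hn hroot hd
  have hge := (isMaxOn_iff.1 hmax) dhat (mem_univ dhat)
  linarith

/-- Conversely the root maximises: `IsMaxOn ℓ_n univ d̂`. -/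
theorem isMaxOn_barLogLik_root (ω : ℕ → E × E) {n : ℕ} (hn : 1 ≤ n) {dhat : ℝ}
    (hroot : (∑ i ∈ range n, Real.sigmoid (dhat - W (ω i).1)) -
      ∑ i ∈ range n, Real.sigmoid (W (ω i).2 - dhat) = 0) :
    IsMaxOn (fun d : ℝ => (∑ i ∈ range n, Real.log (Real.sigmoid (W (ω i).1 - d))) +
      ∑ i ∈ range n, Real.log (Real.sigmoid (d - W (ω i).2))) univ dhat := by
  refine isMaxOn_iff.2 fun d _ => ?_
  rcases eq_or_ne d dhat with rfl | hd
  · exact le_rfl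
  · exact (barLogLik_lt_of_ne_root W ω hn hroot hd).le

/-! ## The observed information -/

/-- **`g_n'(d) = Σ σ'(d − W_F,i) + Σ σ'(W_R,i − d)`** (`σ' = σ(1 − σ)`): minus the second derivative of
the log-likelihood, the observed information, is positive. -/
theorem hasDerivAt_sampleBarGap (ω : ℕ → E × E) (n : ℕ) (d : ℝ) :
    HasDerivAt (fun d : ℝ => (∑ i ∈ range n, Real.sigmoid (d - W (ω i).1)) -
        ∑ i ∈ range n, Real.sigmoid (W (ω i).2 - d))
      ((∑ i ∈ range n, Real.sigmoid (d - W (ω i).1) * (1 - Real.sigmoid (d - W (ω i).1))) +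
        ∑ i ∈ range n, Real.sigmoid (W (ω i).2 - d) * (1 - Real.sigmoid (W (ω i).2 - d))) d := by
  have h1 : HasDerivAt (fun d : ℝ => ∑ i ∈ range n, Real.sigmoid (d - W (ω i).1))
      (∑ i ∈ range n, Real.sigmoid (d - W (ω i).1) * (1 - Real.sigmoid (d - W (ω i).1))) d := by
    refine HasDerivAt.fun_sum fun i _ => ?_
    have := (Real.hasDerivAt_sigmoid (d - W (ω i).1)).comp d ((hasDerivAt_id d).sub_const (W (ω i).1))
    simpa [Function.comp_def] using this
  have h2 : HasDerivAt (fun d : ℝ => ∑ i ∈ range n, Real.sigmoid (W (ω i).2 - d))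
      (∑ i ∈ range n, -(Real.sigmoid (W (ω i).2 - d) * (1 - Real.sigmoid (W (ω i).2 - d)))) d := by
    refine HasDerivAt.fun_sum fun i _ => ?_
    have := (Real.hasDerivAt_sigmoid (W (ω i).2 - d)).comp d
      ((hasDerivAt_const d (W (ω i).2)).sub (hasDerivAt_id d))
    simpa [Function.comp_def] using this
  refine (h1.sub h2).congr_deriv ?_
  rw [sum_neg_distrib, sub_neg_eq_add]

/-- The observed information is positive (`n ≥ 1`). -/
theorem sampleBarGap_deriv_pos (ω : ℕ → E × E) {n : ℕ} (hn : 1 ≤ n) (d : ℝ) :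
    0 < (∑ i ∈ range n, Real.sigmoid (d - W (ω i).1) * (1 - Real.sigmoid (d - W (ω i).1))) +
      ∑ i ∈ range n, Real.sigmoid (W (ω i).2 - d) * (1 - Real.sigmoid (W (ω i).2 - d)) := by
  have hne : (range n).Nonempty := nonempty_range_iff.2 (by omega)
  have hterm : ∀ x : ℝ, 0 < Real.sigmoid x * (1 - Real.sigmoid x) := fun x =>
    mul_pos (Real.sigmoid_pos x) (by linarith [Real.sigmoid_lt_one x])
  exact add_pos (sum_pos (fun i _ => hterm _) hne) (sum_pos (fun i _ => hterm _) hne)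

end Sample

end Summit.Ventures.LatticeQCDFlow.Exactness.GeneralNCMC
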